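import Mathlib
import Literature.Topology.FourManifolds.LatticeFormsParity
import HarnessLib

/-!
# Lagrangian direct summands of unimodular lattices: Wall's transitivity lemma (1964, p. 145)

Topic `Literature/Topology/FourManifolds`, companion of the lattice-form cluster `LatticeForms*.lean`
(unimodularity `LinearMap.BilinForm.IsUnimodular`, parity `IsEven`/`IsOdd`). This file PROVES the
algebraic lemma of C. T. C. Wall, *On simply-connected 4-manifolds*, J. London Math. Soc. 39
(1964), §2, p. 145, used in the proof of his Thm. 2 (isometric intersection forms ⇒ h-cobordant;
tree fact `Literature.Topology.FourManifolds.isHCobordant_of_equivalent_intersectionForm`, layer-1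
reduction `HCobordismWall.lean`) to match the Lagrangian `L = ker (H₂(∂V) → H₂(V))` of a
handlebody with the graph `K` of the given isometry:

> "Clearly, `K` is a free abelian group, in fact a direct summand of `H₂(∂V)`, with rank equal to
> that of `H₂(M₁)`, and so half that of `H₂(∂V)`. Moreover, the subgroup `K` is isotropic …
> let `L` be the kernel of `H₂(∂V) → H₂(V)`; then `L` satisfies the same conditions as `K`. We
> assert that for some automorph `T` of `H = H₂(∂V)`, `T(L) = K`. This is quite a simple result,
> and we briefly sketch the proof. The stated conditions easily imply that `L` (or `K`) is its own
> annihilator in `H`. So `L` is the kernel of the map induced by the quadratic form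
> `H → Hom (H, ℤ) → Hom (L, ℤ)` and if `L'` is a complement to `L`, we may identify `L'` with the
> dual of `L`. We choose dual bases `{eᵢ}` in `L`, `{eᵢ'}` in `L'`, then `eᵢ eⱼ = 0`,
> `eᵢ eⱼ' = δᵢⱼ`. Then we must try varying the choice, by adding to each `eᵢ'` a linear
> combination of the `eⱼ`; when the quadratic form is even, we can make `eᵢ' eⱼ' = 0`, also; when
> it is odd, with a little more trouble, we obtain `eᵢ' eⱼ' = 0` except `e₁' e₁' = 1`. Since the
> same considerations are valid for `K`, we may now use the chosen bases to define an isomorphism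
> which carries `L` to `K`."

## Main statements (all proved; no named facts)

* `exists_isometryEquiv_map_eq_of_isotropic` (**Wall's lemma**): for a symmetric unimodular
  bilinear form `Q` on a finitely generated free `ℤ`-module `V` and two isotropic direct summands
  `L`, `K` of half rank, there is an isometry `T : Q.IsometryEquiv Q` with `T(L) = K`.
* `Lagrangian.exists_isAdapted` — Wall's dual bases: an isotropic direct summand of half rank has
  a basis `e` extending to a basis `(e, f)` of `V` with `Q (e i) (f j) = δ i j`
  (`Lagrangian.IsAdapted`); `y ↦ Q(·, y)|_L` maps a complement `L'` onto `Hom(L, ℤ)` by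
  unimodularity, hence isomorphically (an onto endomorphism of a finitely generated module is
  one-to-one, `OrzechProperty`).
* `Lagrangian.exists_normalForm` — Wall's normal form: the `f`'s can be changed (shears
  `f i ↦ f i + Σ A i j • e j`, `Lagrangian.shear`, and in the odd case one consolidating move
  `Lagrangian.move`) so that their Gram matrix is `0` when `Q` is even and has a single entry `1`
  on the diagonal when `Q` is odd.
* `Lagrangian.exists_isometryEquiv_of_normalForm` — two such normal forms with the same parity
  datum are matched by an isometry carrying `L` to `K`.

## Design notes

* The basis changes are unipotent automorphisms `x ↦ x + N x` with `N² = 0` given by their values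
  on a basis (`Lagrangian.unipotent`), so that invertibility over `ℤ` is free.
* The "little more trouble" of the odd case is made explicit: after a first shear the `f`'s have
  squares `εᵢ ∈ {0, 1}`; if `ε i₀ = 1`, the move `e i₀ ↦ e i₀ + Σ_{i ∈ S} e i`,
  `f i ↦ f i - f i₀` (`i ∈ S = {i ≠ i₀ | εᵢ = 1}`) keeps the pair adapted and makes all squares
  even except at `i₀` (`Lagrangian.IsAdapted.move_sq_emod_two`); a second shear finishes.
* Internally `V` carries the canonical `ℤ`-module structure of an abelian group
  (`AddCommGroup.toIntModule`), which keeps the scalar actions appearing in sums `Σ A i j • e j`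
  and in Mathlib's bilinear-form lemmas syntactically equal; the exported theorem allows an
  arbitrary `[Module ℤ V]` instance and reduces to the internal one by `Subsingleton.elim`
  (all `ℤ`-module structures on an abelian group coincide).
* Declarations live in `namespace Literature.Topology.FourManifolds.Lagrangian` (path namespace
  plus the name of the object), the exported theorem directly in
  `Literature.Topology.FourManifolds`.

## References

* C. T. C. Wall, *On simply-connected 4-manifolds*, J. London Math. Soc. 39 (1964) 141–149, §2,
  p. 145. [WallJLMS1964]
* J.-P. Serre, *A Course in Arithmetic* (1973), Ch. V §1.3.4 (parity on a basis). [Serre1973]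
-/

noncomputable section

open Module

namespace Literature.Topology.FourManifolds

namespace Lagrangian

variable {V : Type*} [AddCommGroup V]

/-! ### Unipotent automorphisms `id + N`, `N² = 0`, from values on a basis -/

section Unipotent

variable {ι : Type*} (b : Basis ι ℤ V) (n : ι → V)

/-- The nilpotent part `N` of a unipotent basis change: the linear map sending the basis vector
`b a` to `n a` (coordinates along `b`, then the corresponding combination of the `n a`).
[folklore] -/
def nil : V →ₗ[ℤ] V := (Finsupp.linearCombination ℤ n).comp b.repr.toLinearMap

/-- `N (b a) = n a`. [folklore] -/
@[simp]
theorem nil_basis (a : ι) : nil b n (b a) = n a := by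
  simp [nil]

/-- If `N` kills all its values on the basis then `N ∘ N = 0`. [folklore] -/
theorem nil_nil (hn : ∀ a, nil b n (n a) = 0) (x : V) : nil b n (nil b n x) = 0 := by
  have : (nil b n).comp (nil b n) = 0 := b.ext fun a => by simp [hn a]
  exact LinearMap.congr_fun this x

/-- The unipotent automorphism `x ↦ x + N x` of `V` (inverse `x ↦ x - N x`) attached to a family of
values `n` on a basis `b` with `N (n a) = 0` for all `a`. [folklore] -/
def unipotent (hn : ∀ a, nil b n (n a) = 0) : V ≃ₗ[ℤ] V :=
  LinearEquiv.ofLinear (LinearMap.id + nil b n) (LinearMap.id - nil b n)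
    (by ext x; simp [nil_nil b n hn])
    (by ext x; simp [nil_nil b n hn])

/-- `unipotent b n hn x = x + N x`. [folklore] -/
@[simp]
theorem unipotent_apply (hn : ∀ a, nil b n (n a) = 0) (x : V) :
    unipotent b n hn x = x + nil b n x := rfl

/-- The inverse is `x ↦ x - N x` (as `N² = 0`). [folklore] -/
@[simp]
theorem unipotent_symm_apply (hn : ∀ a, nil b n (n a) = 0) (x : V) :
    (unipotent b n hn).symm x = x - nil b n x := rfl

/-- The new basis vectors are `b a + n a`. [folklore] -/
theorem map_unipotent_apply (hn : ∀ a, nil b n (n a) = 0) (a : ι) :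
    b.map (unipotent b n hn) a = b a + n a := by
  simp

end Unipotent

/-! ### Bases adapted to a submodule -/

/-- A basis `b` of `V` indexed by `Fin k ⊕ Fin k` is *adapted* to the submodule `L` for the form
`Q` if its first half `e = b ∘ inl` spans `L` and the two halves are dually paired,
`Q (e i) (f j) = δ i j` (`f = b ∘ inr`) — Wall's "dual bases `{eᵢ}` in `L`, `{eᵢ'}` in `L'`",
1964, p. 145. [cite: WallJLMS1964, §2, p. 145] -/
structure IsAdapted (Q : LinearMap.BilinForm ℤ V) (L : Submodule ℤ V) {k : ℕ}
    (b : Basis (Fin k ⊕ Fin k) ℤ V) : Prop where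
  span_eq : Submodule.span ℤ (Set.range (b ∘ Sum.inl)) = L
  dual : ∀ i j, Q (b (Sum.inl i)) (b (Sum.inr j)) = if i = j then 1 else 0

namespace IsAdapted

variable {Q : LinearMap.BilinForm ℤ V} {L : Submodule ℤ V} {k : ℕ} {b : Basis (Fin k ⊕ Fin k) ℤ V}

/-- The first half of an adapted basis lies in `L`. [folklore] -/
theorem inl_mem (h : IsAdapted Q L b) (i : Fin k) : b (Sum.inl i) ∈ L := by
  rw [← h.span_eq]
  exact Submodule.subset_span ⟨i, rfl⟩

/-- `Q` vanishes on the first half of a basis adapted to an isotropic `L`. [folklore] -/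
theorem isotropic (h : IsAdapted Q L b) (hLi : ∀ x ∈ L, ∀ y ∈ L, Q x y = 0) (i j : Fin k) :
    Q (b (Sum.inl i)) (b (Sum.inl j)) = 0 :=
  hLi _ (h.inl_mem i) _ (h.inl_mem j)

/-- `Q (f j) (e i) = δ i j` as well, for symmetric `Q`. [folklore] -/
theorem dual' (h : IsAdapted Q L b) (hQ : Q.IsSymm) (i j : Fin k) :
    Q (b (Sum.inr j)) (b (Sum.inl i)) = if i = j then 1 else 0 := by
  rw [hQ.eq, h.dual]

/-- A unipotent change `id + N` whose nilpotent part maps the first half of an adapted basis into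
`L` preserves `L`: the first half of the new basis again spans `L`. [folklore] -/
theorem span_map_unipotent (h : IsAdapted Q L b) (n : Fin k ⊕ Fin k → V)
    (hn : ∀ a, nil b n (n a) = 0) (hL : ∀ i, n (Sum.inl i) ∈ L) :
    Submodule.span ℤ (Set.range (b.map (unipotent b n hn) ∘ Sum.inl)) = L := by
  have hNL : ∀ x ∈ L, nil b n x ∈ L := by
    intro x hx
    rw [← h.span_eq] at hx
    have hx' : nil b n x ∈ Submodule.span ℤ (nil b n '' Set.range (b ∘ Sum.inl)) := by
      rw [← Submodule.map_span]
      exact Submodule.mem_map_of_mem hx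
    refine (Submodule.span_le.mpr ?_) hx'
    rintro _ ⟨_, ⟨i, rfl⟩, rfl⟩
    simpa using hL i
  have hspan : Submodule.span ℤ (Set.range (b.map (unipotent b n hn) ∘ Sum.inl)) =
      L.map (unipotent b n hn : V →ₗ[ℤ] V) := by
    rw [← h.span_eq, Submodule.map_span, ← Set.range_comp]
    congr 1
  rw [hspan]
  apply le_antisymm
  · rintro _ ⟨x, hx, rfl⟩
    simpa using Submodule.add_mem _ hx (hNL x hx)
  · intro x hx
    refine ⟨(unipotent b n hn).symm x, ?_, LinearEquiv.apply_symm_apply _ _⟩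
    simpa using Submodule.sub_mem _ hx (hNL x hx)

/-- Parity of `Q` read off an adapted basis with diagonal second-half Gram matrix: `Q` is even iff
all `Q (f i) (f i)` are even (the `e i` being isotropic; parity test on a basis,
`LinearMap.BilinForm.isEven_iff_even_apply_basis`, Serre Ch. V §1.3.4). [folklore] -/
theorem isEven_iff (h : IsAdapted Q L b) (hLi : ∀ x ∈ L, ∀ y ∈ L, Q x y = 0) (hQ : Q.IsSymm)
    {ε : Fin k → ℤ} (hG : ∀ i j, Q (b (Sum.inr i)) (b (Sum.inr j)) = if i = j then ε i else 0) :
    Q.IsEven ↔ ∀ i, Even (ε i) := by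
  rw [LinearMap.BilinForm.isEven_iff_even_apply_basis hQ b]
  constructor
  · intro H i
    simpa [hG] using H (Sum.inr i)
  · intro H a
    cases a with
    | inl i => simp [h.isotropic hLi]
    | inr i => simpa [hG] using H i

end IsAdapted

/-! ### Shears: `f i ↦ f i + Σ_j A i j • e j` -/

section Shear

variable {k : ℕ} (b : Basis (Fin k ⊕ Fin k) ℤ V)

/-- The values of the nilpotent part of a shear: `e i ↦ 0`, `f i ↦ Σ_j A i j • e j`. [folklore] -/
def shearFun (A : Fin k → Fin k → ℤ) : Fin k ⊕ Fin k → V :=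
  Sum.elim (fun _ => 0) fun i => ∑ j, A i j • b (Sum.inl j)

/-- A shear does not move the `e i`. [folklore] -/
@[simp]
theorem shearFun_inl (A : Fin k → Fin k → ℤ) (i : Fin k) : shearFun b A (Sum.inl i) = 0 := rfl

/-- A shear moves `f i` by `Σ_j A i j • e j`. [folklore] -/
@[simp]
theorem shearFun_inr (A : Fin k → Fin k → ℤ) (i : Fin k) :
    shearFun b A (Sum.inr i) = ∑ j, A i j • b (Sum.inl j) := rfl

/-- The nilpotent part of a shear has square zero. [folklore] -/
theorem shearFun_nil (A : Fin k → Fin k → ℤ) (a : Fin k ⊕ Fin k) :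
    nil b (shearFun b A) (shearFun b A a) = 0 := by
  cases a with
  | inl i => simp
  | inr i => simp [map_sum]

/-- The sheared basis: `e i ↦ e i`, `f i ↦ f i + Σ_j A i j • e j`. [folklore] -/
def shear (A : Fin k → Fin k → ℤ) : Basis (Fin k ⊕ Fin k) ℤ V :=
  b.map (unipotent b (shearFun b A) (shearFun_nil b A))

/-- The sheared basis has the same first half. [folklore] -/
@[simp]
theorem shear_inl (A : Fin k → Fin k → ℤ) (i : Fin k) : shear b A (Sum.inl i) = b (Sum.inl i) := by
  simp [shear]

/-- The second half of the sheared basis: `f i + Σ_j A i j • e j`. [folklore] -/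
@[simp]
theorem shear_inr (A : Fin k → Fin k → ℤ) (i : Fin k) :
    shear b A (Sum.inr i) = b (Sum.inr i) + ∑ j, A i j • b (Sum.inl j) := by
  simp [shear]

/-- The shear coefficients killing the off-diagonal Gram entries of the second half and reducing
the diagonal ones modulo `2`. [cite: WallJLMS1964, §2, p. 145] -/
def diagCoeff (Q : LinearMap.BilinForm ℤ V) (i j : Fin k) : ℤ :=
  if i < j then -Q (b (Sum.inr i)) (b (Sum.inr j))
  else if i = j then -(Q (b (Sum.inr i)) (b (Sum.inr i)) / 2) else 0

end Shear

namespace IsAdapted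

variable {Q : LinearMap.BilinForm ℤ V} {L : Submodule ℤ V} {k : ℕ} {b : Basis (Fin k ⊕ Fin k) ℤ V}

/-- Shearing an adapted basis gives an adapted basis. [folklore] -/
theorem shear (h : IsAdapted Q L b) (hLi : ∀ x ∈ L, ∀ y ∈ L, Q x y = 0)
    (A : Fin k → Fin k → ℤ) : IsAdapted Q L (shear b A) where
  span_eq := by
    have : (Lagrangian.shear b A : Fin k ⊕ Fin k → V) ∘ Sum.inl = b ∘ Sum.inl :=
      funext fun i => by simp
    rw [this, h.span_eq]
  dual i j := by
    simp [h.dual, h.isotropic hLi]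

/-- **Gram matrix of the second half after a shear**: `Q (f' i) (f' j) = Q (f i) (f j) + A j i + A i j`
(for symmetric `Q`; the cross terms are `δ`'s and the `e`-`e` terms vanish). [cite: WallJLMS1964, §2, p. 145] -/
theorem shear_gram (h : IsAdapted Q L b) (hLi : ∀ x ∈ L, ∀ y ∈ L, Q x y = 0) (hQ : Q.IsSymm)
    (A : Fin k → Fin k → ℤ) (i j : Fin k) :
    Q (Lagrangian.shear b A (Sum.inr i)) (Lagrangian.shear b A (Sum.inr j)) =
      Q (b (Sum.inr i)) (b (Sum.inr j)) + A j i + A i j := by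
  simp only [shear_inr, LinearMap.BilinForm.add_left, LinearMap.BilinForm.add_right,
    LinearMap.BilinForm.sum_left, LinearMap.BilinForm.sum_right, LinearMap.BilinForm.smul_left,
    LinearMap.BilinForm.smul_right, h.dual, h.dual' hQ, h.isotropic hLi, mul_ite, mul_one,
    mul_zero, Finset.sum_ite_eq', Finset.mem_univ, if_true, Finset.sum_const_zero, add_zero]
  ring

/-- **Diagonalisation mod 2** ("we must try varying the choice, by adding to each `eᵢ'` a linear
combination of the `eⱼ`", Wall 1964, p. 145): the shear by `diagCoeff` makes the Gram matrix of
the second half diagonal with entries `Q (f i) (f i) % 2 ∈ {0, 1}`. [cite: WallJLMS1964, §2, p. 145] -/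
theorem diag_gram (h : IsAdapted Q L b) (hLi : ∀ x ∈ L, ∀ y ∈ L, Q x y = 0) (hQ : Q.IsSymm)
    (i j : Fin k) :
    Q (Lagrangian.shear b (diagCoeff b Q) (Sum.inr i))
        (Lagrangian.shear b (diagCoeff b Q) (Sum.inr j)) =
      if i = j then Q (b (Sum.inr i)) (b (Sum.inr i)) % 2 else 0 := by
  rw [h.shear_gram hLi hQ]
  unfold diagCoeff
  rcases lt_trichotomy i j with hij | rfl | hij
  · simp [hij, hij.ne, hij.ne', not_lt.mpr hij.le]
  · simp only [lt_self_iff_false, if_false, if_true]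
    omega
  · simp only [hij, if_true, not_lt.mpr hij.le, hij.ne, hij.ne', if_false]
    rw [hQ.eq (b (Sum.inr i)) (b (Sum.inr j))]
    ring

/-- **Diagonalisation mod 2, packaged**: an adapted basis of an isotropic `L` can be replaced by one
whose second half has diagonal Gram matrix with entries `εᵢ ∈ {0, 1}`, `εᵢ ≡ Q (f i) (f i)`.
[cite: WallJLMS1964, §2, p. 145] -/
theorem exists_diag (h : IsAdapted Q L b) (hLi : ∀ x ∈ L, ∀ y ∈ L, Q x y = 0) (hQ : Q.IsSymm) :
    ∃ b' : Basis (Fin k ⊕ Fin k) ℤ V, IsAdapted Q L b' ∧ ∃ ε : Fin k → ℤ,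
      (∀ i, ε i = 0 ∨ ε i = 1) ∧ (∀ i, ε i = Q (b (Sum.inr i)) (b (Sum.inr i)) % 2) ∧
      ∀ i j, Q (b' (Sum.inr i)) (b' (Sum.inr j)) = if i = j then ε i else 0 :=
  ⟨Lagrangian.shear b (diagCoeff b Q), h.shear hLi _,
    fun i => Q (b (Sum.inr i)) (b (Sum.inr i)) % 2,
    fun _ => Int.emod_two_eq_zero_or_one _, fun _ => rfl, h.diag_gram hLi hQ⟩

end IsAdapted

/-! ### Consolidating the odd case: at most one `f i` of odd square -/

section Move

variable {k : ℕ} (b : Basis (Fin k ⊕ Fin k) ℤ V) (i₀ : Fin k) (S : Finset (Fin k))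

/-- The values of the nilpotent part of the consolidating move ("with a little more trouble",
Wall 1964, p. 145): `e i₀ ↦ Σ_{i ∈ S} e i`, `e a ↦ 0` otherwise; `f a ↦ -f i₀` for `a ∈ S`,
`f a ↦ 0` otherwise. [cite: WallJLMS1964, §2, p. 145] -/
def moveFun : Fin k ⊕ Fin k → V :=
  Sum.elim (fun a => if a = i₀ then ∑ i ∈ S, b (Sum.inl i) else 0)
    fun a => if a ∈ S then -b (Sum.inr i₀) else 0

/-- Values of the move on the first half. [folklore] -/
@[simp]
theorem moveFun_inl (a : Fin k) :
    moveFun b i₀ S (Sum.inl a) = if a = i₀ then ∑ i ∈ S, b (Sum.inl i) else 0 := rfl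

/-- Values of the move on the second half. [folklore] -/
@[simp]
theorem moveFun_inr (a : Fin k) :
    moveFun b i₀ S (Sum.inr a) = if a ∈ S then -b (Sum.inr i₀) else 0 := rfl

/-- The nilpotent part of the move has square zero (as `i₀ ∉ S`). [folklore] -/
theorem moveFun_nil (hS : i₀ ∉ S) (a : Fin k ⊕ Fin k) :
    nil b (moveFun b i₀ S) (moveFun b i₀ S a) = 0 := by
  cases a with
  | inl a =>
    by_cases ha : a = i₀
    · simp only [moveFun_inl, ha, if_true, map_sum, nil_basis]
      exact Finset.sum_eq_zero fun i hi => by simp [ne_of_mem_of_not_mem hi hS]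
    · simp [ha]
  | inr a =>
    by_cases ha : a ∈ S
    · simp [ha, hS]
    · simp [ha]

/-- The consolidated basis: `e i₀ ↦ e i₀ + Σ_{i ∈ S} e i`, `f a ↦ f a - f i₀` (`a ∈ S`), other
vectors unchanged. [cite: WallJLMS1964, §2, p. 145] -/
def move (hS : i₀ ∉ S) : Basis (Fin k ⊕ Fin k) ℤ V :=
  b.map (unipotent b (moveFun b i₀ S) (moveFun_nil b i₀ S hS))

/-- First half of the moved basis: `e i₀ + Σ_{i ∈ S} e i` at `i₀`, `e a` otherwise. [folklore] -/
theorem move_inl (hS : i₀ ∉ S) (a : Fin k) :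
    move b i₀ S hS (Sum.inl a) =
      b (Sum.inl a) + if a = i₀ then ∑ i ∈ S, b (Sum.inl i) else 0 := by
  simp [move]

/-- Second half of the moved basis: `f a - f i₀` for `a ∈ S`, `f a` otherwise. [folklore] -/
theorem move_inr (hS : i₀ ∉ S) (a : Fin k) :
    move b i₀ S hS (Sum.inr a) = b (Sum.inr a) - if a ∈ S then b (Sum.inr i₀) else 0 := by
  by_cases ha : a ∈ S <;> simp [move, ha, sub_eq_add_neg]

end Move

namespace IsAdapted

variable {Q : LinearMap.BilinForm ℤ V} {L : Submodule ℤ V} {k : ℕ} {b : Basis (Fin k ⊕ Fin k) ℤ V}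

/-- The consolidating move of an adapted basis is adapted: the new `e`'s lie in `L` and span it, and
duality is checked case by case (`Q (e i₀ + Σ_S e i) (f c - f i₀) = -1 + 1 = 0` for `c ∈ S`, etc.).
[cite: WallJLMS1964, §2, p. 145] -/
theorem move (h : IsAdapted Q L b) {i₀ : Fin k} {S : Finset (Fin k)} (hS : i₀ ∉ S) :
    IsAdapted Q L (move b i₀ S hS) where
  span_eq := h.span_map_unipotent _ _ fun i => by
    by_cases hi : i = i₀
    · simp only [moveFun_inl, hi, if_true]
      exact Submodule.sum_mem _ fun j _ => h.inl_mem j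
    · simp [hi]
  dual a c := by
    have hci : c ∈ S → c ≠ i₀ := fun hc => ne_of_mem_of_not_mem hc hS
    rw [move_inl, move_inr]
    by_cases ha : a = i₀ <;> by_cases hc : c ∈ S <;>
      simp [ha, hc, LinearMap.BilinForm.sub_right, h.dual, hS, eq_comm]

/-- **Squares after the move**: if the second half of `b` has Gram matrix `diag ε` with
`εᵢ ∈ {0, 1}`, `ε i₀ = 1` and `S = {a ≠ i₀ | ε a = 1}`, then after the move the squares of the
second half are `1` at `i₀`, `2` on `S` and `0` elsewhere — odd exactly at `i₀`.
[cite: WallJLMS1964, §2, p. 145] -/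
theorem move_sq_emod_two {ε : Fin k → ℤ}
    (hG : ∀ i j, Q (b (Sum.inr i)) (b (Sum.inr j)) = if i = j then ε i else 0)
    (hε : ∀ i, ε i = 0 ∨ ε i = 1) {i₀ : Fin k} (h0 : ε i₀ = 1) {S : Finset (Fin k)}
    (hmem : ∀ a, a ∈ S ↔ a ≠ i₀ ∧ ε a = 1) (hS : i₀ ∉ S) (a : Fin k) :
    Q (Lagrangian.move b i₀ S hS (Sum.inr a)) (Lagrangian.move b i₀ S hS (Sum.inr a)) % 2 =
      if a = i₀ then 1 else 0 := by
  rw [move_inr]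
  by_cases ha : a ∈ S
  · obtain ⟨hne, h1⟩ := (hmem a).1 ha
    simp [ha, LinearMap.BilinForm.sub_right, hG, hne, hne.symm, h1, h0]
  · by_cases hai : a = i₀
    · subst hai
      simp [ha, hG, h0]
    · have h0' : ε a = 0 := by
        rcases hε a with h' | h'
        · exact h'
        · exact absurd ((hmem a).2 ⟨hai, h'⟩) ha
      simp [ha, hG, hai, h0']

end IsAdapted

/-! ### An adapted basis exists for a Lagrangian direct summand -/

section Existence

variable [Module.Free ℤ V] [Module.Finite ℤ V] {Q : LinearMap.BilinForm ℤ V}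

/-- **Dual bases for a Lagrangian direct summand** (Wall 1964, p. 145: "`L` is the kernel of the
map induced by the quadratic form `H → Hom (H, ℤ) → Hom (L, ℤ)` and if `L'` is a complement to `L`,
we may identify `L'` with the dual of `L`. We choose dual bases `{eᵢ}` in `L`, `{eᵢ'}` in `L'`").
For a unimodular form `Q` on a lattice `V`, an isotropic direct summand `L` (complement `L'`) of
half rank has an adapted basis: `y ↦ Q(·, y)|_L` maps `L'` onto `Hom(L, ℤ)` (unimodularity and the
projection onto `L` along `L'`), hence isomorphically (equal ranks), and the dual basis of a basis
of `L` pulls back to `L'`. [cite: WallJLMS1964, §2, p. 145] -/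
theorem exists_isAdapted (hU : Q.IsUnimodular) {L L' : Submodule ℤ V} (hc : IsCompl L L')
    (hLi : ∀ x ∈ L, ∀ y ∈ L, Q x y = 0) (hr : 2 * finrank ℤ L = finrank ℤ V) :
    ∃ b : Basis (Fin (finrank ℤ L) ⊕ Fin (finrank ℤ L)) ℤ V, IsAdapted Q L b := by
  classical
  haveI : Q.IsPerfPair := hU
  set k := finrank ℤ L
  let e : Basis (Fin k) ℤ L := Module.finBasis ℤ L
  -- `ψ y = Q(·, y)|_L`
  let ψ : L' →ₗ[ℤ] Module.Dual ℤ L := (Q.flip.domRestrict₂ L).comp L'.subtype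
  have hψ : ∀ (y : L') (x : L), ψ y x = Q x y := fun y x => rfl
  -- `ψ` is onto
  have hsurj : Function.Surjective ψ := by
    intro g
    obtain ⟨y, hy⟩ := (LinearMap.IsPerfPair.bijective_right Q).2
      (g.comp (L.projectionOnto L' hc))
    refine ⟨L'.projectionOnto L hc.symm y, ?_⟩
    ext x
    have hsum := Submodule.projection_add_projection_eq_self hc y
    have h1 : Q x (L.projection L' hc y) = 0 :=
      hLi _ x.2 _ (Submodule.projection_apply_mem hc y)
    have h2 : Q x y = g x := by
      have := LinearMap.congr_fun hy x
      simpa [Submodule.projectionOnto_apply_left] using this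
    rw [hψ, Submodule.coe_projectionOnto_apply]
    conv_rhs => rw [← h2, ← hsum]
    rw [LinearMap.BilinForm.add_right, h1, zero_add]
  -- ranks
  have hL' : finrank ℤ L' = k := by
    have h1 := (Submodule.prodEquivOfIsCompl L L' hc).finrank_eq
    rw [Module.finrank_prod] at h1
    omega
  let f' : Basis (Fin k) ℤ L' := (Module.finBasis ℤ L').reindex (finCongr hL')
  -- `ψ` is one-to-one: an onto endomorphism of `L'` is one-to-one
  have hinj : Function.Injective ψ := by
    let θ : Module.Dual ℤ L ≃ₗ[ℤ] L' := e.dualBasis.equiv f' (Equiv.refl _)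
    have hθ : Function.Injective (θ ∘ ψ) :=
      OrzechProperty.injective_of_surjective_endomorphism (θ.toLinearMap.comp ψ)
        (θ.surjective.comp hsurj)
    exact hθ.of_comp
  let Φ : L' ≃ₗ[ℤ] Module.Dual ℤ L := LinearEquiv.ofBijective ψ ⟨hinj, hsurj⟩
  let f : Basis (Fin k) ℤ L' := e.dualBasis.map Φ.symm
  let b : Basis (Fin k ⊕ Fin k) ℤ V := (e.prod f).map (Submodule.prodEquivOfIsCompl L L' hc)
  have hb_inl : ∀ i, b (Sum.inl i) = (e i : V) := fun i => by
    simp [b, Basis.prod_apply, Submodule.coe_prodEquivOfIsCompl']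
  have hb_inr : ∀ j, b (Sum.inr j) = (f j : V) := fun j => by
    simp [b, Basis.prod_apply, Submodule.coe_prodEquivOfIsCompl']
  refine ⟨b, ⟨?_, fun i j => ?_⟩⟩
  · have hrange : Set.range (b ∘ Sum.inl) = L.subtype '' Set.range e := by
      ext x
      simp only [Set.mem_range, Function.comp_apply, hb_inl, Set.mem_image, Submodule.coe_subtype,
        exists_exists_eq_and]
    rw [hrange, ← Submodule.map_span, e.span_eq, Submodule.map_top, Submodule.range_subtype]
  · have hf : ψ (f j) = e.dualBasis j := by
      change Φ (Φ.symm (e.dualBasis j)) = e.dualBasis j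
      exact Φ.apply_symm_apply _
    rw [hb_inl, hb_inr, ← hψ, hf, Module.Basis.dualBasis_apply_self]

end Existence

/-! ### Wall's normal form -/

section NormalForm

variable {Q : LinearMap.BilinForm ℤ V} {L : Submodule ℤ V}

/-- Reindexing a normal form along `σ : Fin m ≃ Fin k`. [folklore] -/
theorem normalForm_reindex {m k : ℕ} {w : Basis (Fin m ⊕ Fin m) ℤ V} (hw : IsAdapted Q L w)
    {o : Option (Fin m)}
    (hG : ∀ i j, Q (w (Sum.inr i)) (w (Sum.inr j)) = if i = j ∧ o = some i then 1 else 0)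
    (σ : Fin m ≃ Fin k) :
    IsAdapted Q L (w.reindex (Equiv.sumCongr σ σ)) ∧
      ∀ i j, Q (w.reindex (Equiv.sumCongr σ σ) (Sum.inr i))
          (w.reindex (Equiv.sumCongr σ σ) (Sum.inr j)) =
        if i = j ∧ o.map σ = some i then 1 else 0 := by
  refine ⟨⟨?_, fun i j => ?_⟩, fun i j => ?_⟩
  · rw [← hw.span_eq]
    congr 1
    ext x
    simp only [Set.mem_range, Function.comp_apply, Basis.reindex_apply, Equiv.sumCongr_symm,
      Equiv.sumCongr_apply, Sum.map_inl]
    exact ⟨fun ⟨i, hi⟩ => ⟨σ.symm i, hi⟩, fun ⟨i, hi⟩ => ⟨σ i, by simpa using hi⟩⟩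
  · simp [hw.dual, σ.symm.injective.eq_iff]
  · simp only [Basis.reindex_apply, Equiv.sumCongr_symm, Equiv.sumCongr_apply, Sum.map_inr, hG,
      σ.symm.injective.eq_iff]
    cases o with
    | none => simp
    | some i₁ =>
      simp only [Option.map_some, Option.some.injEq, Equiv.eq_symm_apply]

/-- **Wall's normal form for a Lagrangian direct summand** (1964, p. 145: "We choose dual bases
`{eᵢ}` in `L`, `{eᵢ'}` in `L'`, then `eᵢ eⱼ = 0`, `eᵢ eⱼ' = δᵢⱼ`. Then we must try varying the
choice, by adding to each `eᵢ'` a linear combination of the `eⱼ`; when the quadratic form is even,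
we can make `eᵢ' eⱼ' = 0`, also; when it is odd, with a little more trouble, we obtain
`eᵢ' eⱼ' = 0` except `e₁' e₁' = 1`"). For a symmetric unimodular form `Q` on a lattice `V` and an
isotropic direct summand `L` of half rank there is an adapted basis whose second half has Gram
matrix `0` (exactly when `Q` is even) or `diag(0, …, 1, …, 0)` with a single `1`, at `i₀` (exactly
when `Q` is odd); encoded by `o = none`, resp. `o = some i₀`. [cite: WallJLMS1964, §2, p. 145] -/
theorem exists_normalForm [Module.Free ℤ V] [Module.Finite ℤ V] (hQ : Q.IsSymm)
    (hU : Q.IsUnimodular) {L' : Submodule ℤ V} (hc : IsCompl L L')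
    (hLi : ∀ x ∈ L, ∀ y ∈ L, Q x y = 0) (hr : 2 * finrank ℤ L = finrank ℤ V) :
    ∃ (b : Basis (Fin (finrank ℤ L) ⊕ Fin (finrank ℤ L)) ℤ V) (o : Option (Fin (finrank ℤ L))),
      IsAdapted Q L b ∧ (o = none ↔ Q.IsEven) ∧
      ∀ i j, Q (b (Sum.inr i)) (b (Sum.inr j)) = if i = j ∧ o = some i then 1 else 0 := by
  classical
  obtain ⟨b₀, h₀⟩ := exists_isAdapted hU hc hLi hr
  obtain ⟨b₁, h₁, ε, hε, -, hG₁⟩ := h₀.exists_diag hLi hQ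
  by_cases hev : ∀ i, ε i = 0
  · refine ⟨b₁, none, h₁, ?_, fun i j => ?_⟩
    · simp only [true_iff]
      exact (h₁.isEven_iff hLi hQ hG₁).2 fun i => by simp [hev i]
    · simp [hG₁, hev]
  · push Not at hev
    obtain ⟨i₀, hi₀⟩ := hev
    have h0 : ε i₀ = 1 := (hε i₀).resolve_left hi₀
    let S : Finset (Fin (finrank ℤ L)) := Finset.univ.filter fun a => a ≠ i₀ ∧ ε a = 1
    have hmem : ∀ a, a ∈ S ↔ a ≠ i₀ ∧ ε a = 1 := fun a => by simp [S]
    have hS : i₀ ∉ S := fun h' => ((hmem i₀).1 h').1 rfl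
    obtain ⟨b₃, h₃, ε₃, -, hε₃, hG₃⟩ := (h₁.move hS).exists_diag hLi hQ
    have hε₃' : ∀ a, ε₃ a = if a = i₀ then 1 else 0 := fun a => by
      rw [hε₃ a]
      exact IsAdapted.move_sq_emod_two hG₁ hε h0 hmem hS a
    refine ⟨b₃, some i₀, h₃, ?_, fun i j => ?_⟩
    · simp only [reduceCtorEq, false_iff]
      intro hE
      have := (h₃.isEven_iff hLi hQ hG₃).1 hE i₀
      rw [hε₃', if_pos rfl] at this
      exact Int.not_even_one this
    · rw [hG₃]
      by_cases hij : i = j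
      · subst hij
        simp [hε₃', eq_comm]
      · simp [hij]

end NormalForm

/-! ### Transitivity on Lagrangian direct summands -/

section Transitivity

variable {Q : LinearMap.BilinForm ℤ V}

/-- Two bases with the same Gram matrix differ by an isometry of `Q` carrying one to the other
(a bilinear form is determined by its Gram matrix, `LinearMap.BilinForm.ext_basis`). [folklore] -/
theorem exists_isometryEquiv_of_gram_eq {ι : Type*} (v w : Basis ι ℤ V)
    (hG : ∀ a c, Q (v a) (v c) = Q (w a) (w c)) :
    ∃ T : Q.IsometryEquiv Q, ∀ a, T (v a) = w a := by
  have key : Q.comp (v.equiv w (Equiv.refl ι)).toLinearMap (v.equiv w (Equiv.refl ι)).toLinearMap =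
      Q := by
    refine LinearMap.BilinForm.ext_basis v fun a c => ?_
    simp only [LinearMap.BilinForm.comp_apply, LinearEquiv.coe_coe, Basis.equiv_apply,
      Equiv.refl_apply, hG]
  refine ⟨{ v.equiv w (Equiv.refl ι) with
    map_app' := fun x y => ?_ }, fun a => ?_⟩
  · change Q (v.equiv w (Equiv.refl ι) x) (v.equiv w (Equiv.refl ι) y) = Q x y
    simpa only [LinearMap.BilinForm.comp_apply, LinearEquiv.coe_coe] using
      LinearMap.congr_fun₂ key x y
  · change v.equiv w (Equiv.refl ι) (v a) = w a
    simp

/-- **Transitivity, normal-form version**: adapted bases of `L` and of `K` with the same full Gram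
matrix give an isometry `T` of `Q` with `T(L) = K`. [cite: WallJLMS1964, §2, p. 145] -/
theorem exists_isometryEquiv_of_normalForm (hQ : Q.IsSymm) {L K : Submodule ℤ V}
    (hLi : ∀ x ∈ L, ∀ y ∈ L, Q x y = 0) (hKi : ∀ x ∈ K, ∀ y ∈ K, Q x y = 0) {k : ℕ}
    {v w : Basis (Fin k ⊕ Fin k) ℤ V} (hv : IsAdapted Q L v) (hw : IsAdapted Q K w)
    {o : Option (Fin k)}
    (hGv : ∀ i j, Q (v (Sum.inr i)) (v (Sum.inr j)) = if i = j ∧ o = some i then 1 else 0)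
    (hGw : ∀ i j, Q (w (Sum.inr i)) (w (Sum.inr j)) = if i = j ∧ o = some i then 1 else 0) :
    ∃ T : Q.IsometryEquiv Q, Submodule.map (T.toLinearEquiv : V →ₗ[ℤ] V) L = K := by
  have hG : ∀ a c, Q (v a) (v c) = Q (w a) (w c) := by
    rintro (i | i) (j | j)
    · rw [hv.isotropic hLi, hw.isotropic hKi]
    · rw [hv.dual, hw.dual]
    · rw [hv.dual' hQ, hw.dual' hQ]
    · rw [hGv, hGw]
  obtain ⟨T, hT⟩ := exists_isometryEquiv_of_gram_eq v w hG
  refine ⟨T, ?_⟩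
  rw [← hv.span_eq, ← hw.span_eq, Submodule.map_span, ← Set.range_comp]
  congr 1
  ext x
  simp only [Set.mem_range, Function.comp_apply]
  constructor
  · rintro ⟨i, rfl⟩
    exact ⟨i, (hT (Sum.inl i)).symm⟩
  · rintro ⟨i, rfl⟩
    exact ⟨i, hT (Sum.inl i)⟩

/-- **Wall's lemma, internal form** (canonical `ℤ`-module structure; see
`exists_isometryEquiv_map_eq_of_isotropic` for the exported statement). [cite: WallJLMS1964, §2, p. 145] -/
theorem exists_isometryEquiv_map_eq_aux [Module.Free ℤ V] [Module.Finite ℤ V] (hQ : Q.IsSymm)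
    (hU : Q.IsUnimodular) {L L' K K' : Submodule ℤ V} (hcL : IsCompl L L') (hcK : IsCompl K K')
    (hLi : ∀ x ∈ L, ∀ y ∈ L, Q x y = 0) (hKi : ∀ x ∈ K, ∀ y ∈ K, Q x y = 0)
    (hLr : 2 * finrank ℤ L = finrank ℤ V) (hKr : 2 * finrank ℤ K = finrank ℤ V) :
    ∃ T : Q.IsometryEquiv Q, Submodule.map (T.toLinearEquiv : V →ₗ[ℤ] V) L = K := by
  classical
  obtain ⟨v, oL, hv, hoL, hGv⟩ := exists_normalForm hQ hU hcL hLi hLr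
  obtain ⟨w₀, oK, hw₀, hoK, hGw₀⟩ := exists_normalForm hQ hU hcK hKi hKr
  have hk : finrank ℤ K = finrank ℤ L := by omega
  -- choose the reindexing so that the odd positions match
  obtain ⟨σ, hσ⟩ : ∃ σ : Fin (finrank ℤ K) ≃ Fin (finrank ℤ L), oK.map σ = oL := by
    cases hK : oK with
    | none =>
      refine ⟨finCongr hk, ?_⟩
      rw [Option.map_none, eq_comm, hoL, ← hoK]
      exact hK
    | some i₁ =>
      cases hL : oL with
      | none =>
        exact absurd ((hoK.2 (hoL.1 hL)).symm.trans hK) (by simp)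
      | some i₀ =>
        refine ⟨(finCongr hk).trans (Equiv.swap (finCongr hk i₁) i₀), ?_⟩
        simp
  obtain ⟨hw, hGw⟩ := normalForm_reindex hw₀ hGw₀ σ
  rw [hσ] at hGw
  exact exists_isometryEquiv_of_normalForm hQ hLi hKi hv hw hGv hGw

end Transitivity

end Lagrangian

/-! ### The exported statement -/

/-- **Wall's transitivity lemma for Lagrangian direct summands** (C. T. C. Wall, *On
simply-connected 4-manifolds*, J. London Math. Soc. 39 (1964), §2, p. 145: for `H = H₂(∂V)` with
its (unimodular, symmetric) intersection form, `K` "a free abelian group, in fact a direct summand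
of `H₂(∂V)`, with rank … half that of `H₂(∂V)`. Moreover, the subgroup `K` is isotropic", and `L`
satisfying "the same conditions as `K`": "We assert that for some automorph `T` of `H`,
`T(L) = K`. This is quite a simple result, and we briefly sketch the proof."). **Let `Q` be a
symmetric unimodular bilinear form on a finitely generated free `ℤ`-module `V`, and let `L`, `K`
be direct summands of `V` of half rank on which `Q` vanishes identically. Then there is an
isometry `T` of `(V, Q)` with `T(L) = K`.** Proof as sketched by Wall: dual bases adapted to `L`
(`Lagrangian.exists_isAdapted`), shears `eᵢ' ↦ eᵢ' + Σ aᵢⱼ eⱼ` reducing the Gram matrix of the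
`eᵢ'` to `0` (even case) or to a single `1` (odd case, after a consolidating move)
(`Lagrangian.exists_normalForm`), and the isometry matching two normal forms
(`Lagrangian.exists_isometryEquiv_of_normalForm`). Hypotheses as printed (direct summand, half
rank, isotropic; `Q` unimodular and symmetric as an intersection form of a closed oriented
4-manifold is); any `ℤ`-module structure on `V` is allowed (they all coincide).
[cite: WallJLMS1964, §2, p. 145] -/
theorem exists_isometryEquiv_map_eq_of_isotropic {V : Type*} [AddCommGroup V] [inst : Module ℤ V]
    [Module.Free ℤ V] [Module.Finite ℤ V] {Q : LinearMap.BilinForm ℤ V} (hQ : Q.IsSymm)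
    (hU : Q.IsUnimodular) {L K : Submodule ℤ V}
    (hL : ∃ L' : Submodule ℤ V, IsCompl L L') (hLi : ∀ x ∈ L, ∀ y ∈ L, Q x y = 0)
    (hLr : 2 * finrank ℤ L = finrank ℤ V)
    (hK : ∃ K' : Submodule ℤ V, IsCompl K K') (hKi : ∀ x ∈ K, ∀ y ∈ K, Q x y = 0)
    (hKr : 2 * finrank ℤ K = finrank ℤ V) :
    ∃ T : Q.IsometryEquiv Q, Submodule.map (T.toLinearEquiv : V →ₗ[ℤ] V) L = K := by
  obtain rfl : inst = AddCommGroup.toIntModule V := Subsingleton.elim _ _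
  obtain ⟨L', hcL⟩ := hL
  obtain ⟨K', hcK⟩ := hK
  exact Lagrangian.exists_isometryEquiv_map_eq_aux hQ hU hcL hcK hLi hKi hLr hKr

end Literature.Topology.FourManifolds

end
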